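import Summits.Langlands.Langlands.Theorems.IrreducibilityBySelfDualityPairLBoundaryJSCornerUnitBoxProductForm

/-!
# Crux `PairLBoundaryJS` (stmt-Langlands-13622), line `Sketch` — stub `stub_gap_unitBox_productForm` (G-PF),
# part 1: the `GL_n × GL_m` corner local value theorem at a bad place

Summit `Langlands`, sub-problem `Langlands`, helper file under `Theorems/` supporting the crux
`PairLBoundaryJS` (Arthur–Clozel (1989), Ch. 3, (2.2)), line `Sketch`, registered stub
`stub_gap_unitBox_productForm` (proved in `…PairLBoundaryJSGapUnitBoxProductForm`; part 2 is
`…GapUnitBoxPeel`); this file proves the registered sub-goal `stub_gap_unitBox_localValue`. This is the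
`GL_n × GL_m` (`m ≤ n - 1`) generalisation of the corner file `…CornerUnitBoxLocalValue` (`GL_{m+1} × GL_m`).

The finite-place content of the bad-place step of the Rankin–Selberg method for the pair `GL_n × GL_m`
(Jacquet–Piatetski-Shapiro–Shalika (1983), §2, (2.7)): the first function `W` lives on `GL_n(𝔸_K)` and is
evaluated along the corner `ι = glCorner (m ≤ n) : g ↦ diag(g, 1_{n-m})`, whose rows of index `≥ m` are standard
basis vectors; in particular its last row is EXACTLY `e_n`, so the thin hypothesis of the support theorems of
`…UnitBoxTranslateLocalValue` holds at every depth.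

* `glCorner_last_apply`, `glCorner_mem_valuedCongruenceSubgroup_iff`, `colUnipotent_mem_valuedCongruenceSubgroup`,
  `level_colUnipotent` — `diag(·, 1_{n-m})` and the column unipotents `u(b) = 1 + Σ_{i<m} b_i E_{i,m}` of `GL_n`
  against the congruence subgroups and the spread level set (any `m ≤ n`);
* `sharp_descent` — **descent of `ι(x) ∈ N_v K♯_v` to `GL_m` along the tower `GL_m ⊂ GL_{m+1} ⊂ ⋯ ⊂ GL_n`**:
  for `W` spread at `v` and `K♯_v = {k ∈ K_{n,v}(𝔭^M) : W(g ι_v(k)) = W(g) ∀ g}`, if `ι(x) = u k` with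
  `u ∈ N_n(K_v)`, `k ∈ K♯_v`, then `x = u₁ k₁` with `u₁ ∈ N_m(K_v)` and `ι(k₁) ∈ K♯_v` (induction on `n - m`,
  one corner step `CornerUnitBoxProductForm.corner_descent` at a time: the column unipotents `u(∓b)`,
  `|b_i| ≤ exp(-M)`, lie in `K_v(𝔭^M)` and in the spread level set);
* `gap_pair_apply_mul_ofLocal_eq` (= `stub_gap_unitBox_localValue`) — **the `GL_n × GL_m` local value theorem**:
  for `W` left `ψ`-equivariant on `GL_n(𝔸_K)` and spread at `v`, `W'` left `ψ`-equivariant on `GL_m(𝔸_K)` and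
  right `K_v(𝔭^M)`-invariant, base points `G'`, `g'` with trivial `v`-components and ANY `x ∈ GL_m(K_v)`:
  `W(G' ι_v(ι x)) W̄'(g' ι_v(x)) = 𝟙[ι(x) ∈ N_v K♯_v] · W(G') W̄'(g')`.

All proofs complete; tree theorems only.

## References

* H. Jacquet, I. I. Piatetski-Shapiro, J. A. Shalika, *Rankin–Selberg convolutions*, Amer. J. Math.
  105 (1983), §2, (2.7) [JacquetPiatetskiShapiroShalika1983].
* J. W. Cogdell, *Analytic theory of L-functions for GL_n*, in *An Introduction to the Langlands
  Program* (2004), §2.3, §4.1 [CogdellAnalyticTheory2004].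
-/

noncomputable section

-- `Summit.Langlands.Langlands.…` (summit = sub-problem name, D-0017 layout) trips `dupNamespace`
set_option linter.dupNamespace false

open scoped MatrixGroups Topology Pointwise ENNReal NNReal ComplexConjugate InnerProductSpace ContDiff
-- the place subtypes indexing `mixedSpace K` are `Fintype` classically (`NormedCommRing (mixedSpace K)`)
open scoped Classical Matrix.Norms.Operator
open NumberField IsDedekindDomain MeasureTheory Measure Matrix Set Filter WithZero
open NumberField.mixedEmbedding
open Literature.NumberTheory.Automorphic AdelicGroupData
open Literature.NumberTheory.GaloisRepresentations (ideleGroup HeckeCharacter)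
open ValuativeRel

-- no local instances needed in this file (algebra and pointwise statements only)

namespace Summit.Langlands.Langlands.Theorems.GapUnitBoxProductForm

/-! ### The corner `diag(·, 1_{n-m})` and the column unipotents of `GL_n` against the congruence subgroups -/

section Algebra

variable {m n : ℕ} {K : Type} [Field K] [NumberField K] {v : HeightOneSpectrum (𝓞 K)}

/-- The last row of `diag(x, 1_{n+1-m})` is `e_{n+1}` as soon as `m ≤ n`. [folklore] -/
theorem glCorner_last_apply (h : m ≤ n + 1) (hm : m ≤ n) (x : GL (Fin m) (v.adicCompletion K)) (j : Fin (n + 1)) :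
    ((glCorner (v.adicCompletion K) h x : GL (Fin (n + 1)) (v.adicCompletion K)) :
        Matrix (Fin (n + 1)) (Fin (n + 1)) (v.adicCompletion K)) (Fin.last n) j =
      if j = Fin.last n then 1 else 0 := by
  rw [glCorner_apply_val, dif_neg (by rw [Fin.val_last]; omega)]
  by_cases hj : (j : ℕ) < m
  · rw [if_pos hj, if_neg]
    rintro rfl
    rw [Fin.val_last] at hj
    omega
  · rw [if_neg hj]
    by_cases hjl : j = Fin.last n
    · rw [if_pos hjl, if_pos hjl.symm]
    · rw [if_neg hjl, if_neg (Ne.symm hjl)]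

/-- The entries of `diag(g, 1_{n-m})` are integral when those of `g` are. [folklore] -/
theorem valued_glCorner_apply_le_one (h : m ≤ n) {g : GL (Fin m) (v.adicCompletion K)}
    (hg : ∀ i j, Valued.v ((g : Matrix (Fin m) (Fin m) (v.adicCompletion K)) i j) ≤ 1) (i j : Fin n) :
    Valued.v (((glCorner (v.adicCompletion K) h g : GL (Fin n) (v.adicCompletion K)) :
      Matrix (Fin n) (Fin n) (v.adicCompletion K)) i j) ≤ 1 := by
  rw [glCorner_apply_val]
  by_cases hi : (i : ℕ) < m <;> by_cases hj : (j : ℕ) < m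
  · rw [dif_pos hi, dif_pos hj]; exact hg _ _
  · rw [dif_pos hi, dif_neg hj, Valuation.map_zero]; exact zero_le
  · rw [dif_neg hi, if_pos hj, Valuation.map_zero]; exact zero_le
  · rw [dif_neg hi, if_neg hj]
    split_ifs
    · rw [Valuation.map_one]
    · rw [Valuation.map_zero]; exact zero_le

/-- The congruence `diag(g, 1_{n-m}) ≡ 1` is that of `g`. [folklore] -/
theorem valued_glCorner_sub_one_apply_le (h : m ≤ n) {g : GL (Fin m) (v.adicCompletion K)} {c : ℤᵐ⁰}
    (hg : ∀ i j, Valued.v (((g : Matrix (Fin m) (Fin m) (v.adicCompletion K)) - 1) i j) ≤ c) (i j : Fin n) :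
    Valued.v ((((glCorner (v.adicCompletion K) h g : GL (Fin n) (v.adicCompletion K)) :
      Matrix (Fin n) (Fin n) (v.adicCompletion K)) - 1) i j) ≤ c := by
  rw [Matrix.sub_apply, glCorner_apply_val, Matrix.one_apply]
  by_cases hi : (i : ℕ) < m <;> by_cases hj : (j : ℕ) < m
  · rw [dif_pos hi, dif_pos hj]
    have h := hg ⟨i, hi⟩ ⟨j, hj⟩
    rw [Matrix.sub_apply, Matrix.one_apply] at h
    have hij : ((⟨i, hi⟩ : Fin m) = ⟨j, hj⟩) ↔ i = j := by simp only [Fin.ext_iff]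
    simp only [hij] at h
    exact h
  · have hij : i ≠ j := fun h => hj (h ▸ hi)
    rw [dif_pos hi, dif_neg hj, if_neg hij, sub_zero, Valuation.map_zero]; exact zero_le
  · have hij : i ≠ j := fun h => hi (h ▸ hj)
    rw [dif_neg hi, if_pos hj, if_neg hij, sub_zero, Valuation.map_zero]; exact zero_le
  · rw [dif_neg hi, if_neg hj, sub_self, Valuation.map_zero]; exact zero_le

/-- **`diag(g, 1_{n-m}) ∈ K_{n,v}(c) ↔ g ∈ K_{m,v}(c)`** for the valued congruence subgroups of any radius `c`
(`glCorner_apply_castLE` for the direct implication). [folklore] -/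
theorem glCorner_mem_valuedCongruenceSubgroup_iff (h : m ≤ n) {c : ℤᵐ⁰} (g : GL (Fin m) (v.adicCompletion K)) :
    glCorner (v.adicCompletion K) h g ∈ valuedCongruenceSubgroup (Fin n) c ↔
      g ∈ valuedCongruenceSubgroup (Fin m) c := by
  constructor
  · intro hg
    obtain ⟨h1, h2, h3⟩ := mem_valuedCongruenceSubgroup_iff.1 hg
    rw [← map_inv] at h2
    refine mem_valuedCongruenceSubgroup_iff.2 ⟨fun i j => ?_, fun i j => ?_, fun i j => ?_⟩
    · rw [← glCorner_apply_castLE h]; exact h1 _ _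
    · rw [← glCorner_apply_castLE h]; exact h2 _ _
    · have h' := h3 (Fin.castLE h i) (Fin.castLE h j)
      rw [Matrix.sub_apply, glCorner_apply_castLE, Matrix.one_apply] at h'
      simp only [Fin.castLE_inj] at h'
      rw [Matrix.sub_apply, Matrix.one_apply]
      exact h'
  · intro hg
    obtain ⟨h1, h2, h3⟩ := mem_valuedCongruenceSubgroup_iff.1 hg
    refine mem_valuedCongruenceSubgroup_iff.2 ⟨valued_glCorner_apply_le_one h h1, fun i j => ?_,
      valued_glCorner_sub_one_apply_le h h3⟩
    rw [← map_inv]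
    exact valued_glCorner_apply_le_one h h2 i j

/-- The entries of `u(b) - 1` in `GL_n`: `b_i` at `(i, m)` for `i < m`, `0` elsewhere. [folklore] -/
theorem colUnipotent_sub_one_apply (h : m ≤ n) (b : Fin m → v.adicCompletion K) (i j : Fin n) :
    (((colUnipotent n h (Multiplicative.ofAdd b) : GL (Fin n) (v.adicCompletion K)) :
        Matrix (Fin n) (Fin n) (v.adicCompletion K)) - 1) i j =
      if hi : (i : ℕ) < m then (if (j : ℕ) = m then b ⟨i, hi⟩ else 0) else 0 := by
  rw [Matrix.sub_apply, colUnipotent_apply_val, Matrix.one_apply]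
  ring

/-- `|(u(b) - 1)_{ij}| ≤ c` when `|b_i| ≤ c`. [folklore] -/
theorem valued_colUnipotent_sub_one_apply_le (h : m ≤ n) {b : Fin m → v.adicCompletion K} {c : ℤᵐ⁰}
    (hb : ∀ i, Valued.v (b i) ≤ c) (i j : Fin n) :
    Valued.v ((((colUnipotent n h (Multiplicative.ofAdd b) : GL (Fin n) (v.adicCompletion K)) :
        Matrix (Fin n) (Fin n) (v.adicCompletion K)) - 1) i j) ≤ c := by
  rw [colUnipotent_sub_one_apply]
  split_ifs
  · exact hb _
  · rw [Valuation.map_zero]; exact zero_le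
  · rw [Valuation.map_zero]; exact zero_le

/-- The entries of `u(b)` are integral when `|b_i| ≤ 1`. [folklore] -/
theorem valued_colUnipotent_apply_le_one (h : m ≤ n) {b : Fin m → v.adicCompletion K}
    (hb : ∀ i, Valued.v (b i) ≤ 1) (i j : Fin n) :
    Valued.v (((colUnipotent n h (Multiplicative.ofAdd b) : GL (Fin n) (v.adicCompletion K)) :
        Matrix (Fin n) (Fin n) (v.adicCompletion K)) i j) ≤ 1 := by
  rw [← sub_add_cancel (((colUnipotent n h (Multiplicative.ofAdd b) : GL (Fin n) (v.adicCompletion K)) :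
      Matrix (Fin n) (Fin n) (v.adicCompletion K)) i j) ((1 : Matrix (Fin n) (Fin n) (v.adicCompletion K)) i j),
    ← Matrix.sub_apply]
  refine (Valuation.map_add _ _ _).trans (max_le (valued_colUnipotent_sub_one_apply_le h hb i j) ?_)
  rw [Matrix.one_apply]
  split_ifs
  · rw [Valuation.map_one]
  · rw [Valuation.map_zero]; exact zero_le

/-- **`u(b) ∈ K_{n,v}(c)` when `|b_i| ≤ c ≤ 1`** (`u(b)⁻¹ = u(-b)`). [folklore] -/
theorem colUnipotent_mem_valuedCongruenceSubgroup (h : m ≤ n) {b : Fin m → v.adicCompletion K} {c : ℤᵐ⁰}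
    (hc : c ≤ 1) (hb : ∀ i, Valued.v (b i) ≤ c) :
    colUnipotent n h (Multiplicative.ofAdd b) ∈ valuedCongruenceSubgroup (Fin n) c := by
  have hb1 : ∀ i, Valued.v (b i) ≤ 1 := fun i => (hb i).trans hc
  have hnb1 : ∀ i, Valued.v ((-b) i) ≤ 1 := fun i => by rw [Pi.neg_apply, Valuation.map_neg]; exact hb1 i
  refine mem_valuedCongruenceSubgroup_iff.2
    ⟨valued_colUnipotent_apply_le_one h hb1, fun i j => ?_, valued_colUnipotent_sub_one_apply_le h hb⟩
  rw [← map_inv, ← ofAdd_neg]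
  exact valued_colUnipotent_apply_le_one h hnb1 i j

/-- **`u(b)` lies in the spread level set of `(t, M)` when `|b_i| ≤ exp(-M)`**:
`|(u(b) - 1)_{ij} t_j| ≤ exp(-M) |t_i|` (only `(i, m)`, `i < m`, contributes, and `|t_m| ≤ |t_i|`). [folklore] -/
theorem level_colUnipotent (h : m ≤ n) {b : Fin m → v.adicCompletion K} {t : Fin n → (v.adicCompletion K)ˣ} {M : ℤ}
    (hmono : ∀ i j : Fin n, i ≤ j → Valued.v (t j : v.adicCompletion K) ≤ Valued.v (t i : v.adicCompletion K))
    (hb : ∀ i, Valued.v (b i) ≤ exp (-M)) (i j : Fin n) :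
    Valued.v ((((colUnipotent n h (Multiplicative.ofAdd b) : GL (Fin n) (v.adicCompletion K)) :
        Matrix (Fin n) (Fin n) (v.adicCompletion K)) - 1) i j * t j) ≤
      exp (-M) * Valued.v (t i : v.adicCompletion K) := by
  rw [colUnipotent_sub_one_apply]
  by_cases hi : (i : ℕ) < m
  · rw [dif_pos hi]
    by_cases hj : (j : ℕ) = m
    · rw [if_pos hj, Valuation.map_mul]
      exact mul_le_mul' (hb _) (hmono i j (Fin.le_def.2 (by omega)))
    · rw [if_neg hj, zero_mul, Valuation.map_zero]; exact zero_le
  · rw [dif_neg hi, zero_mul, Valuation.map_zero]; exact zero_le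

end Algebra

/-! ### Descent of `ι(x) ∈ N_v K♯_v` along the tower `GL_m ⊂ GL_{m+1} ⊂ ⋯ ⊂ GL_n` -/

section Descent

variable {N : ℕ} {K : Type} [Field K] [NumberField K] {v : HeightOneSpectrum (𝓞 K)}
  {ψ : AddChar (AdeleRing (𝓞 K) K) Circle} {W : GL (Fin N) (AdeleRing (𝓞 K) K) → ℂ}
  {t : Fin N → (v.adicCompletion K)ˣ} {M : ℤ}

/-- **Descent of `ι(x) ∈ N_v K♯_v` to `GL_m`, by induction on the codimension `d = n - m`.** For `W` spread at
`v` (`IsSpreadWhittakerAt v ψ t M W` on `GL_n`, `M ≥ 0`, `|t_j| ≤ |t_i|` for `i ≤ j`) and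
`K♯_v = {k ∈ K_{n,v}(𝔭^M) : W(g ι_v(k)) = W(g) ∀ g}`: if `diag(x, 1_{n-m}) = u k` with `u ∈ N_n(K_v)`, `k ∈ K♯_v`,
then `x = u₁ k₁` with `u₁ ∈ N_m(K_v)` and `diag(k₁, 1_{n-m}) ∈ K♯_v`. The step `m + 1 → m`: by the hypothesis at
`m + 1` applied to `diag(x, 1) ∈ GL_{m+1}` (`glCorner_glCorner`), `diag(x, 1) = u₁' k₁'` with
`diag(k₁', 1_{n-m-1}) ∈ K♯_v`; by `corner_descent`, `diag(k₁, 1) = u(-b) k₁'` with `|b_i| = |(k₁')_{i m}| ≤ exp(-M)`,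
and the column unipotent `u(∓b)` of `GL_n` (`colUnipotent_eq_glCorner_colUnipotent`) lies in `K_v(𝔭^M)` and in the
spread level set (`level_colUnipotent`, `IsSpreadWhittakerAt.level`). [folklore] -/
theorem sharp_descent_aux (hW : IsSpreadWhittakerAt v ψ t M W) (hM₀ : 0 ≤ M)
    (hmono : ∀ i j : Fin N, i ≤ j → Valued.v (t j : v.adicCompletion K) ≤ Valued.v (t i : v.adicCompletion K)) :
    ∀ (d m : ℕ) (_ : m + d = N) (h : m ≤ N) (x : GL (Fin m) (v.adicCompletion K))
      (u k : GL (Fin N) (v.adicCompletion K)),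
      u ∈ upperUnitriangular (Fin N) (v.adicCompletion K) →
      k ∈ valuedCongruenceSubgroup (Fin N) (exp (-M)) →
      (∀ g : GL (Fin N) (AdeleRing (𝓞 K) K), W (g * GLn.ofLocal N K v k) = W g) →
      glCorner (v.adicCompletion K) h x = u * k →
      ∃ u₁ ∈ upperUnitriangular (Fin m) (v.adicCompletion K), ∃ k₁ : GL (Fin m) (v.adicCompletion K),
        (glCorner (v.adicCompletion K) h k₁ ∈ valuedCongruenceSubgroup (Fin N) (exp (-M)) ∧
          ∀ g : GL (Fin N) (AdeleRing (𝓞 K) K),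
            W (g * GLn.ofLocal N K v (glCorner (v.adicCompletion K) h k₁)) = W g) ∧
        x = u₁ * k₁ := by
  have hexpM : exp (-M) ≤ (1 : ℤᵐ⁰) := by rw [← exp_zero, exp_le_exp]; omega
  intro d
  induction d with
  | zero =>
    intro m hm h x u k hu hk hkW hx
    obtain rfl : m = N := by omega
    rw [glCorner_refl] at hx
    exact ⟨u, hu, k, ⟨by rwa [glCorner_refl], fun g => by rw [glCorner_refl]; exact hkW g⟩, hx⟩
  | succ d ih =>
    intro m hm h x u k hu hk hkW hx
    have h' : m + 1 ≤ N := by omega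
    rw [← glCorner_glCorner h h'] at hx
    obtain ⟨u₁', hu₁', k₁', ⟨hk₁'K, hk₁'W⟩, hx'⟩ := ih (m + 1) (by omega) h' _ u k hu hk hkW hx
    obtain ⟨b, k₁, hb, hbk, hu₁⟩ := CornerUnitBoxProductForm.corner_descent hu₁' hx'
    -- `|b_i| = |(k₁')_{i m}| ≤ exp(-M)`
    have hk₁'K' : k₁' ∈ valuedCongruenceSubgroup (Fin (m + 1)) (exp (-M)) :=
      (glCorner_mem_valuedCongruenceSubgroup_iff h' k₁').1 hk₁'K
    have hbv : ∀ i, Valued.v (b i) ≤ exp (-M) := fun i => by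
      have h3 := (mem_valuedCongruenceSubgroup_iff.1 hk₁'K').2.2 (Fin.castSucc i) (Fin.last m)
      rw [Matrix.sub_apply, Matrix.one_apply_ne (Fin.castSucc_lt_last i).ne, sub_zero, ← hb i] at h3
      exact h3
    have hnbv : ∀ i, Valued.v ((-b) i) ≤ exp (-M) := fun i => by rw [Pi.neg_apply, Valuation.map_neg]; exact hbv i
    -- `diag(k₁, 1_{n-m}) = u(-b) diag(k₁', 1_{n-m-1})` with `u(-b)` the column unipotent of `GL_n`
    set C : GL (Fin N) (v.adicCompletion K) := colUnipotent N h (Multiplicative.ofAdd (-b)) with hC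
    have he : glCorner (v.adicCompletion K) (Nat.le_succ m) k₁ =
        colUnipotent (m + 1) (Nat.le_succ m) (Multiplicative.ofAdd (-b)) * k₁' := by
      rw [← hbk, ← mul_assoc, ofAdd_neg, map_inv, inv_mul_cancel, one_mul]
    have hCk : glCorner (v.adicCompletion K) h k₁ = C * glCorner (v.adicCompletion K) h' k₁' := by
      rw [← glCorner_glCorner h h' k₁, he, map_mul, hC, colUnipotent_eq_glCorner_colUnipotent h h']
    have hCK : C ∈ valuedCongruenceSubgroup (Fin N) (exp (-M)) := colUnipotent_mem_valuedCongruenceSubgroup h hexpM hnbv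
    have hCW : ∀ g : GL (Fin N) (AdeleRing (𝓞 K) K), W (g * GLn.ofLocal N K v C) = W g := by
      refine hW.level C (level_colUnipotent h hmono hnbv) (fun i j => ?_)
      rw [hC, ← map_inv, ← ofAdd_neg, neg_neg]
      exact level_colUnipotent h hmono hbv i j
    refine ⟨x * k₁⁻¹, hu₁, k₁, ⟨?_, fun g => ?_⟩, (inv_mul_cancel_right x k₁).symm⟩
    · rw [hCk]; exact mul_mem hCK hk₁'K
    · rw [hCk, map_mul, ← mul_assoc, hk₁'W, hCW]

/-- **Descent of `ι(x) ∈ N_v K♯_v` to `GL_m`** (`sharp_descent_aux` at `d = n - m`): if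
`diag(x, 1_{n-m}) = u k` with `u ∈ N_n(K_v)` and `k ∈ K♯_v`, then `x = u₁ k₁` with `u₁ ∈ N_m(K_v)` and
`diag(k₁, 1_{n-m}) ∈ K♯_v`. [folklore] -/
theorem sharp_descent {m : ℕ} (hW : IsSpreadWhittakerAt v ψ t M W) (hM₀ : 0 ≤ M)
    (hmono : ∀ i j : Fin N, i ≤ j → Valued.v (t j : v.adicCompletion K) ≤ Valued.v (t i : v.adicCompletion K))
    (h : m ≤ N) {x : GL (Fin m) (v.adicCompletion K)} {u k : GL (Fin N) (v.adicCompletion K)}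
    (hu : u ∈ upperUnitriangular (Fin N) (v.adicCompletion K))
    (hk : k ∈ valuedCongruenceSubgroup (Fin N) (exp (-M)))
    (hkW : ∀ g : GL (Fin N) (AdeleRing (𝓞 K) K), W (g * GLn.ofLocal N K v k) = W g)
    (hx : glCorner (v.adicCompletion K) h x = u * k) :
    ∃ u₁ ∈ upperUnitriangular (Fin m) (v.adicCompletion K), ∃ k₁ : GL (Fin m) (v.adicCompletion K),
      (glCorner (v.adicCompletion K) h k₁ ∈ valuedCongruenceSubgroup (Fin N) (exp (-M)) ∧
        ∀ g : GL (Fin N) (AdeleRing (𝓞 K) K),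
          W (g * GLn.ofLocal N K v (glCorner (v.adicCompletion K) h k₁)) = W g) ∧
      x = u₁ * k₁ :=
  sharp_descent_aux hW hM₀ hmono (N - m) m (by omega) h x u k hu hk hkW hx

end Descent

/-! ### The `GL_n × GL_m` local value theorem at a bad place -/

section LocalValue

variable {m n : ℕ} {K : Type} [Field K] [NumberField K] {v : HeightOneSpectrum (𝓞 K)}
  {ψ : AddChar (AdeleRing (𝓞 K) K) Circle}
  {W : GL (Fin (n + 1)) (AdeleRing (𝓞 K) K) → ℂ} {W' : GL (Fin m) (AdeleRing (𝓞 K) K) → ℂ}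
  {t : Fin (n + 1) → (v.adicCompletion K)ˣ} {M c₀ : ℤ} {d : ℕ}

/-- **The `GL_{n+1} × GL_m` local value theorem at a bad place** (`m ≤ n`; Jacquet–Piatetski-Shapiro–Shalika
(1983), (2.7), in the tree's form). Let `W` on `GL_{n+1}(𝔸_K)` be left `ψ`-equivariant and spread at `v` (with the
usual hypotheses on `ψ_v`, `M`, `t`, and a depth `d` with `exp(-d)|t_0| ≤ exp(-M)|t_n|`), `W'` on `GL_m(𝔸_K)` left
`ψ`-equivariant and right `K_{m,v}(𝔭^M)`-invariant, `G'`, `g'` base points with trivial `v`-components and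
`x ∈ GL_m(K_v)` ARBITRARY, `ι = diag(·, 1_{n+1-m})`. Then
`W(G' ι_v(ι x)) W̄'(g' ι_v(x)) = 𝟙[ι(x) ∈ N_v K♯_v] · W(G') W̄'(g')`: off `N_v K♯_v` the first factor vanishes, the
last row of `ι(x)` being exactly `e_{n+1}` (`exists_sharp_of_ne_zero` at depth `d`, `glCorner_last_apply`); on it
`sharp_descent` gives `x = u₁ k₁` with `ι(k₁) ∈ K♯_v`, both functions take the value `ψ_v(u₁) ×` (value at the
base point) (`whittakerCharFun_glCornerU`), and the phases cancel. [folklore] -/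
theorem gap_pair_apply_mul_ofLocal_eq (h : m ≤ n + 1) (hm : m ≤ n)
    (hWN : ∀ (u : ↥(adelicUnipotent (n + 1) K)) (g : GL (Fin (n + 1)) (AdeleRing (𝓞 K) K)),
      W ((u : GL (Fin (n + 1)) (AdeleRing (𝓞 K) K)) * g) = whittakerCharFun ψ u * W g)
    (hW'N : ∀ (u : ↥(adelicUnipotent m K)) (g : GL (Fin m) (AdeleRing (𝓞 K) K)),
      W' ((u : GL (Fin m) (AdeleRing (𝓞 K) K)) * g) = whittakerCharFun ψ u * W' g)
    (hW : IsSpreadWhittakerAt v ψ t M W)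
    (hψv : ∃ y : v.adicCompletion K, Valued.v y ≤ exp (1 - c₀) ∧ ψ.adicComponent v y ≠ 1) (hM₁ : 1 ≤ M)
    (hmono : ∀ i j : Fin (n + 1), i ≤ j → Valued.v (t j : v.adicCompletion K) ≤ Valued.v (t i : v.adicCompletion K))
    (hgap : ∀ i j : Fin (n + 1), (i : ℕ) + 1 = j →
      exp (M - c₀) * Valued.v (t j : v.adicCompletion K) ≤ Valued.v (t i : v.adicCompletion K))
    (hmt : exp (-(d : ℤ)) * Valued.v (t 0 : v.adicCompletion K) ≤
      exp (-M) * Valued.v (t (Fin.last n) : v.adicCompletion K))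
    (hW'K : ∀ κ ∈ valuedCongruenceSubgroup (Fin m) (exp (-M)), ∀ g : GL (Fin m) (AdeleRing (𝓞 K) K),
      W' (g * GLn.ofLocal m K v κ) = W' g)
    {G' : GL (Fin (n + 1)) (AdeleRing (𝓞 K) K)} (hG' : localComponent v G' = 1)
    {g' : GL (Fin m) (AdeleRing (𝓞 K) K)} (hg' : localComponent v g' = 1) (x : GL (Fin m) (v.adicCompletion K)) :
    W (G' * GLn.ofLocal (n + 1) K v (glCorner (v.adicCompletion K) h x)) *
        star (W' (g' * GLn.ofLocal m K v x)) =
      (if ∃ u ∈ upperUnitriangular (Fin (n + 1)) (v.adicCompletion K), ∃ k : GL (Fin (n + 1)) (v.adicCompletion K),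
          (k ∈ valuedCongruenceSubgroup (Fin (n + 1)) (exp (-M)) ∧
            ∀ g : GL (Fin (n + 1)) (AdeleRing (𝓞 K) K), W (g * GLn.ofLocal (n + 1) K v k) = W g) ∧
            glCorner (v.adicCompletion K) h x = u * k
        then (1 : ℂ) else 0) * (W G' * star (W' g')) := by
  split_ifs with hJ
  · obtain ⟨u, hu, k, ⟨hkK, hkW⟩, hxuk⟩ := hJ
    obtain ⟨u₁, hu₁, k₁, ⟨hk₁K, hk₁W⟩, rfl⟩ := sharp_descent hW (by omega) hmono h hu hkK hkW hxuk
    have hWv : W (G' * GLn.ofLocal (n + 1) K v (glCorner (v.adicCompletion K) h (u₁ * k₁))) =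
        whittakerCharFun (ψ.adicComponent v) ⟨u₁, hu₁⟩ * W G' := by
      rw [map_mul, UnitBoxTranslateProductForm.apply_mul_ofLocal_unipotent_mul_sharp hWN hG'
        (glCorner_mem_upperUnitriangular h hu₁) hk₁W]
      exact congrArg (· * W G') (whittakerCharFun_glCornerU (ψ.adicComponent v) h ⟨u₁, hu₁⟩)
    have hW'v : W' (g' * GLn.ofLocal m K v (u₁ * k₁)) = whittakerCharFun (ψ.adicComponent v) ⟨u₁, hu₁⟩ * W' g' := by
      rw [map_mul, ← mul_assoc, hW'K k₁ ((glCorner_mem_valuedCongruenceSubgroup_iff h k₁).1 hk₁K),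
        CornerUnitBoxProductForm.apply_mul_ofLocal_unipotent' hW'N hg' hu₁]
    rw [hWv, hW'v, star_mul', one_mul]
    calc whittakerCharFun (ψ.adicComponent v) ⟨u₁, hu₁⟩ * W G' *
          (star (whittakerCharFun (ψ.adicComponent v) ⟨u₁, hu₁⟩) * star (W' g'))
        = (whittakerCharFun (ψ.adicComponent v) ⟨u₁, hu₁⟩ * star (whittakerCharFun (ψ.adicComponent v) ⟨u₁, hu₁⟩)) *
            (W G' * star (W' g')) := by ring
      _ = W G' * star (W' g') := by rw [UnitBoxTranslateProductForm.whittakerCharFun_mul_star, one_mul]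
  · rw [zero_mul]
    by_cases hne : W (G' * GLn.ofLocal (n + 1) K v (glCorner (v.adicCompletion K) h x)) = 0
    · rw [hne, zero_mul]
    · refine absurd (UnitBoxTranslateProductForm.exists_sharp_of_ne_zero hWN hW hψv hM₁ hmono hgap hmt hG'
        (fun j => ?_) hne) hJ
      rw [glCorner_last_apply h hm, sub_self, Valuation.map_zero]
      exact zero_le

end LocalValue

/-! ### The registered sub-goal: the `GL_n × GL_m` local value theorem -/

section SubGoal

/-- **SUB-GOAL (G-PF, part 1) — the `GL_{n+1} × GL_m` local value theorem at a bad place** (`m ≤ n`), `∀`-form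
of `gap_pair_apply_mul_ofLocal_eq`: for `W` left `ψ`-equivariant on `GL_{n+1}(𝔸_K)` and spread at `v`, `W'` left
`ψ`-equivariant on `GL_m(𝔸_K)` and right `K_{m,v}(𝔭^M)`-invariant, base points `G'`, `g'` with trivial
`v`-components and any `x ∈ GL_m(K_v)`:
`W(G' ι_v(diag(x, 1_{n+1-m}))) W̄'(g' ι_v(x)) = 𝟙[diag(x, 1_{n+1-m}) ∈ N_v K♯_v] · W(G') W̄'(g')`
(Jacquet–Piatetski-Shapiro–Shalika (1983), (2.7)). [folklore] -/
theorem stub_gap_unitBox_localValue :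
    ∀ {m n : ℕ} {K : Type} [Field K] [NumberField K] {v : HeightOneSpectrum (𝓞 K)} {ψ : AddChar (AdeleRing (𝓞 K) K) Circle}
      {W : GL (Fin (n + 1)) (AdeleRing (𝓞 K) K) → ℂ} {W' : GL (Fin m) (AdeleRing (𝓞 K) K) → ℂ}
      {t : Fin (n + 1) → (v.adicCompletion K)ˣ} {M c₀ : ℤ} {d : ℕ} (h : m ≤ n + 1) (_ : m ≤ n)
      (_ : ∀ (u : ↥(adelicUnipotent (n + 1) K)) (g : GL (Fin (n + 1)) (AdeleRing (𝓞 K) K)), W ((u : GL (Fin (n + 1)) (AdeleRing (𝓞 K) K)) * g) = whittakerCharFun ψ u * W g)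
      (_ : ∀ (u : ↥(adelicUnipotent m K)) (g : GL (Fin m) (AdeleRing (𝓞 K) K)), W' ((u : GL (Fin m) (AdeleRing (𝓞 K) K)) * g) = whittakerCharFun ψ u * W' g)
      (_ : IsSpreadWhittakerAt v ψ t M W) (_ : ∃ y : v.adicCompletion K, Valued.v y ≤ exp (1 - c₀) ∧ ψ.adicComponent v y ≠ 1) (_ : 1 ≤ M)
      (_ : ∀ i j : Fin (n + 1), i ≤ j → Valued.v (t j : v.adicCompletion K) ≤ Valued.v (t i : v.adicCompletion K))
      (_ : ∀ i j : Fin (n + 1), (i : ℕ) + 1 = j → exp (M - c₀) * Valued.v (t j : v.adicCompletion K) ≤ Valued.v (t i : v.adicCompletion K))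
      (_ : exp (-(d : ℤ)) * Valued.v (t 0 : v.adicCompletion K) ≤ exp (-M) * Valued.v (t (Fin.last n) : v.adicCompletion K))
      (_ : ∀ κ ∈ valuedCongruenceSubgroup (Fin m) (exp (-M)), ∀ g : GL (Fin m) (AdeleRing (𝓞 K) K), W' (g * GLn.ofLocal m K v κ) = W' g)
      {G' : GL (Fin (n + 1)) (AdeleRing (𝓞 K) K)} (_ : localComponent v G' = 1)
      {g' : GL (Fin m) (AdeleRing (𝓞 K) K)} (_ : localComponent v g' = 1) (x : GL (Fin m) (v.adicCompletion K)),
    W (G' * GLn.ofLocal (n + 1) K v (glCorner (v.adicCompletion K) h x)) * star (W' (g' * GLn.ofLocal m K v x)) = (if ∃ u ∈ upperUnitriangular (Fin (n + 1)) (v.adicCompletion K), ∃ k : GL (Fin (n + 1)) (v.adicCompletion K), (k ∈ valuedCongruenceSubgroup (Fin (n + 1)) (exp (-M)) ∧ ∀ g : GL (Fin (n + 1)) (AdeleRing (𝓞 K) K), W (g * GLn.ofLocal (n + 1) K v k) = W g) ∧ glCorner (v.adicCompletion K) h x = u * k then (1 : ℂ) else 0) * (W G' * star (W' g')) := by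
  intro m n K _ _ v ψ W W' t M c₀ d h hm hWN hW'N hW hψv hM₁ hmono hgap hmt hW'K G' hG' g' hg' x
  exact gap_pair_apply_mul_ofLocal_eq h hm hWN hW'N hW hψv hM₁ hmono hgap hmt hW'K hG' hg' x

end SubGoal

end Summit.Langlands.Langlands.Theorems.GapUnitBoxProductForm
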